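import Literature.NumberTheory.LFunctions.StarkExceptionalZeroProofs
import HarnessLib

/-!
# The entire completion `ξ(s, χ) = s(s−1)γ_K(s)L(s, χ)` of a class group `L`-function

Topic `Literature/NumberTheory/LFunctions` (namespace `Literature.NumberTheory.LFunctions.NumberField`),
continuing `StarkExceptionalZeroProofs.lean` (`exists_starkXi`: the case `χ = 1`, `ξ_K = s ζ₁_K γ_K`) and
`ClassGroupLFunctionRootNumber.lean` (`Λ(1 − s, χ) = χ([𝔡_K]) Λ(s, χ⁻¹)`).  Everything here is PROVED
(three definitions with bodies — `classXiG`, `classRootNumber`, `classXi` — and theorems).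

For EVERY class group character `χ` of a number field `K` (trivial or not) put
`G_χ(s) = s · Z₁_χ(s) · γ_K(s)` (`classXiG`; `Z₁_χ(s) = (s − 1)L(s, χ)` entire, `classTwistedZeta₁`;
`γ_K = |d_K|^{s/2}Γ_ℝ^{r₁}Γ_ℂ^{r₂}`), holomorphic on `Re s > 0` with
`G_χ(1 − s) = W(χ) G_{χ⁻¹}(s)` off the integers, `W(χ) = χ([𝔡_K])`, `W(χ)W(χ⁻¹) = 1`.  Gluing along
`Re s = 1/2` gives the ENTIRE function (`classXi`)

  `ξ(s, χ) = G_χ(s)` (`Re s ≥ 1/2`), `= W(χ) G_{χ⁻¹}(1 − s)` (`Re s < 1/2`),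

with `ξ(1 − s, χ) = W(χ) ξ(s, χ⁻¹)` for all `s`, `ξ(s, χ) = s(s−1)γ_K(s)L(s,χ)` for `Re s > 0`, growth
`‖ξ(s, χ)‖ ≤ C exp(‖s‖^{15/8})`, zeros in `0 ≤ Re s ≤ 1`, `ξ(1, χ) = 0` for `χ ≠ 1`, and every zero `ρ`
of `L(s, χ)` with `Re ρ > 0`, `ρ ≠ 1` a zero of `ξ(·, χ)`.  The symmetric pair `ξ(s,χ)ξ(s,χ⁻¹)` (to
which the tree's symmetric Hadamard expansion applies) is in `ClassGroupXiPair.lean`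
[cite: LagariasMontgomeryOdlyzko1979, §3] [cite: ThornerZaman2017, §7].

## References

* J. Neukirch, *Algebraic Number Theory*, Springer 1999, VII (8.5)–(8.6). [NeukirchANT1999]
* J. C. Lagarias, H. L. Montgomery, A. M. Odlyzko, Invent. Math. 54 (1979), §3. [LagariasMontgomeryOdlyzko1979]
* J. Thorner, A. Zaman, Algebra Number Theory 11 (2017), §7. [ThornerZaman2017]
-/

noncomputable section

open scoped NumberField
open Complex Filter Topology Set Metric NumberField NumberField.InfinitePlace

namespace Literature.NumberTheory.LFunctions.NumberField

variable (K : Type*) [Field K] [NumberField K]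

/-! ### `G_χ(s) = s · Z₁_χ(s) · γ_K(s)` -/

/-- `G_χ(s) = s · Z₁_χ(s) · γ_K(s) = s(s−1)γ_K(s)L(s,χ)`. [cite: NeukirchANT1999, Ch. VII (8.5)] -/
def classXiG (χ : ClassGroup (𝓞 K) →* ℂˣ) (s : ℂ) : ℂ :=
  s * classTwistedZeta₁ K (fun C ↦ (χ C : ℂ)) s * dedekindGammaFactor K s

/-- The root number `W(χ) = χ([𝔡_K])`. [cite: NeukirchANT1999, Ch. VII (8.6)] -/
def classRootNumber (χ : ClassGroup (𝓞 K) →* ℂˣ) : ℂ := (χ (differentClass K) : ℂ)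

variable {K}

/-- `G_χ(s) = s(s−1) · γ_K(s) L(s,χ)` off `s = 1`. [folklore] -/
theorem classXiG_eq (χ : ClassGroup (𝓞 K) →* ℂˣ) {s : ℂ} (hs : s ≠ 1) :
    classXiG K χ s = s * (s - 1) * (dedekindGammaFactor K s * classGroupLFunction K χ s) := by
  rw [classXiG, ← sub_one_mul_classGroupLFunction χ hs]
  ring

omit [NumberField K] in
/-- `χ⁻¹⁻¹ = χ`. [folklore] -/
theorem classGroupChar_inv_inv (χ : ClassGroup (𝓞 K) →* ℂˣ) : χ⁻¹⁻¹ = χ := by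
  ext C; simp

/-- `W(χ) W(χ⁻¹) = 1`. [folklore] -/
theorem classRootNumber_mul_inv (χ : ClassGroup (𝓞 K) →* ℂˣ) :
    classRootNumber K χ * classRootNumber K χ⁻¹ = 1 := by
  rw [classRootNumber, classRootNumber, MonoidHom.inv_apply, Units.val_inv_eq_inv_val,
    mul_inv_cancel₀ (Units.ne_zero _)]

/-- `|W(χ)| = 1`. [cite: NeukirchANT1999, Ch. VII (8.6)] -/
theorem norm_classRootNumber (χ : ClassGroup (𝓞 K) →* ℂˣ) : ‖classRootNumber K χ‖ = 1 :=
  norm_rootNumber χ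

/-- **Functional equation** `G_χ(1 − s) = W(χ) G_{χ⁻¹}(s)` off the integers.
[cite: NeukirchANT1999, Ch. VII (8.6)] -/
theorem classXiG_one_sub (χ : ClassGroup (𝓞 K) →* ℂˣ) {s : ℂ} (hs : ∀ n : ℤ, s ≠ n) :
    classXiG K χ (1 - s) = classRootNumber K χ * classXiG K χ⁻¹ s := by
  have hs1 : s ≠ 1 := by simpa using hs 1
  have hs0 : s ≠ 0 := by simpa using hs 0
  have h1s : (1 - s) ≠ 1 := fun h ↦ hs0 (by linear_combination -h)
  rw [classXiG_eq χ h1s, classXiG_eq χ⁻¹ hs1, completedClassGroupLFunction_one_sub χ hs,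
    classRootNumber]
  ring

/-- `G_χ` is differentiable on `Re s > 0`. [folklore] -/
theorem differentiableAt_classXiG (χ : ClassGroup (𝓞 K) →* ℂˣ) {s : ℂ} (hs : 0 < s.re) :
    DifferentiableAt ℂ (classXiG K χ) s :=
  (differentiableAt_id.mul (differentiable_classTwistedZeta₁ _ s)).mul
    (differentiableAt_dedekindGammaFactor (ne_neg_nat_of_re_pos hs))

/-- `G_χ(s) ≠ 0` for `Re s > 1`. [folklore] -/
theorem classXiG_ne_zero_of_one_lt_re (χ : ClassGroup (𝓞 K) →* ℂˣ) {s : ℂ} (hs : 1 < s.re) :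
    classXiG K χ s ≠ 0 := by
  have hs1 : s ≠ 1 := fun h ↦ by rw [h, one_re] at hs; exact lt_irrefl _ hs
  have hs0 : s ≠ 0 := fun h ↦ by rw [h, zero_re] at hs; linarith
  rw [classXiG_eq χ hs1]
  exact mul_ne_zero (mul_ne_zero hs0 (sub_ne_zero.mpr hs1))
    (mul_ne_zero (dedekindGammaFactor_ne_zero_of_re_pos (by linarith))
      (classGroupLFunction_ne_zero_of_one_lt_re K χ hs))

/-- For `χ ≠ 1`, `G_χ(1) = 0` (the factor `s − 1`: `Z₁_χ(1) = κ_K Σ_C χ(C) = 0`). [folklore] -/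
theorem classXiG_one {χ : ClassGroup (𝓞 K) →* ℂˣ} (hχ : χ ≠ 1) : classXiG K χ 1 = 0 := by
  rw [classXiG, classTwistedZeta₁_one_eq_zero hχ]; ring

/-- A zero `ρ ≠ 1`, `Re ρ > 0` of `L(s, χ)` is a zero of `G_χ`. [folklore] -/
theorem classXiG_eq_zero_of_classGroupLFunction_eq_zero (χ : ClassGroup (𝓞 K) →* ℂˣ) {ρ : ℂ}
    (hρ1 : ρ ≠ 1) (h : classGroupLFunction K χ ρ = 0) : classXiG K χ ρ = 0 := by
  rw [classXiG_eq χ hρ1, h]; ring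

variable (K) in
/-- **Growth of `G_χ` on `Re s ≥ 1/2`**: `‖G_χ(s)‖ ≤ C exp(‖s‖^{7/4})` (convexity bound
`norm_classTwistedZeta₁_le`, `norm_dedekindGammaFactor_le`; verbatim as `exists_norm_starkG_le`).
[folklore] -/
theorem exists_norm_classXiG_le (χ : ClassGroup (𝓞 K) →* ℂˣ) :
    ∃ C : ℝ, 0 ≤ C ∧ ∀ s : ℂ, 1 / 2 ≤ s.re →
      ‖classXiG K χ s‖ ≤ C * Real.exp (‖s‖ ^ (7 / 4 : ℝ)) := by
  set d : ℝ := ((discr K).natAbs : ℝ) with hd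
  set n : ℕ := Module.finrank ℚ K with hn
  set r₁ : ℕ := nrRealPlaces K with hr₁
  set r₂ : ℕ := nrComplexPlaces K with hr₂
  have hd1 : 1 ≤ d := by
    rw [hd]
    exact_mod_cast Nat.one_le_iff_ne_zero.mpr (Int.natAbs_ne_zero.mpr (discr_ne_zero K))
  have hlogd : 0 ≤ Real.log d := Real.log_nonneg hd1
  set k : ℝ := 1 + (n + 1) + (Real.log d + 2 * r₁ + 2 * r₂) with hk
  have hk0 : 0 ≤ k := by rw [hk]; positivity
  set C₀ : ℝ := d * Real.exp (2 * n) * (4 ^ r₁ * 8 ^ r₂) with hC₀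
  have hC₀0 : 0 ≤ C₀ := by rw [hC₀]; positivity
  obtain ⟨A, hA0, hA⟩ := Stark1974.exists_mul_add_rpow_le (μ := 3 / 2) (μ' := 7 / 4) (c := k)
    (a := 5 / 2) (by norm_num) (by norm_num) hk0 (by norm_num)
  refine ⟨C₀ * Real.exp A, by positivity, fun s hs ↦ ?_⟩
  set y : ℝ := ‖s‖ + 5 / 2 with hy
  set Y : ℝ := y ^ (3 / 2 : ℝ) with hY
  have hy1 : 1 ≤ y := by rw [hy]; linarith [norm_nonneg s]
  have hy0 : 0 ≤ y := by linarith
  have hyY : y ≤ Y := le_rpow_three_halves hy1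
  have hY0 : 0 ≤ Y := by linarith
  have hf1 : ‖s‖ ≤ Real.exp (1 * Y) := by
    rw [one_mul]
    calc ‖s‖ ≤ y := by rw [hy]; linarith
      _ ≤ Y := hyY
      _ ≤ Real.exp Y := by linarith [Real.add_one_le_exp Y]
  have hf2 : ‖classTwistedZeta₁ K (fun C ↦ (χ C : ℂ)) s‖ ≤
      d * Real.exp (2 * n) * Real.exp ((n + 1 : ℕ) * Y) := by
    have h := norm_classTwistedZeta₁_le (K := K) (a := fun C ↦ (χ C : ℂ))
      (fun C ↦ (norm_classGroupChar_apply χ C).le) (z := s) (by linarith)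
    have hn5 : ‖s + 5 / 2‖ ≤ y := by
      rw [hy]
      calc ‖s + 5 / 2‖ ≤ ‖s‖ + ‖(5 / 2 : ℂ)‖ := norm_add_le _ _
        _ = ‖s‖ + 5 / 2 := by norm_num
    calc ‖classTwistedZeta₁ K (fun C ↦ (χ C : ℂ)) s‖
        ≤ d * Real.exp (2 * n) * ‖s + 5 / 2‖ ^ (n + 1) := h
      _ ≤ d * Real.exp (2 * n) * y ^ (n + 1) := by gcongr
      _ ≤ d * Real.exp (2 * n) * Real.exp ((n + 1 : ℕ) * y) := by
          gcongr
          calc y ^ (n + 1) ≤ (Real.exp y) ^ (n + 1) := by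
                gcongr
                linarith [Real.add_one_le_exp y]
            _ = Real.exp ((n + 1 : ℕ) * y) := by rw [← Real.exp_nat_mul]
      _ ≤ d * Real.exp (2 * n) * Real.exp ((n + 1 : ℕ) * Y) := by gcongr
  have hf3 := norm_dedekindGammaFactor_le (K := K) hs
  rw [← hd, ← hr₁, ← hr₂, ← hy, ← hY] at hf3
  have hprod : ‖classXiG K χ s‖ ≤ C₀ * Real.exp (k * Y) := by
    rw [classXiG, norm_mul, norm_mul]
    calc ‖s‖ * ‖classTwistedZeta₁ K (fun C ↦ (χ C : ℂ)) s‖ * ‖dedekindGammaFactor K s‖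
        ≤ Real.exp (1 * Y) * (d * Real.exp (2 * n) * Real.exp ((n + 1 : ℕ) * Y)) *
            (4 ^ r₁ * 8 ^ r₂ * Real.exp ((Real.log d + 2 * r₁ + 2 * r₂) * Y)) := by
          gcongr
      _ = C₀ * Real.exp (k * Y) := by
          rw [hC₀, hk]
          have : (1 + ((n : ℝ) + 1) + (Real.log d + 2 * r₁ + 2 * r₂)) * Y =
              1 * Y + ((n + 1 : ℕ) : ℝ) * Y + (Real.log d + 2 * r₁ + 2 * r₂) * Y := by
            push_cast; ring
          rw [this, Real.exp_add, Real.exp_add]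
          ring
  have hkY : k * Y ≤ ‖s‖ ^ (7 / 4 : ℝ) + A := by
    have := hA ‖s‖ (norm_nonneg s)
    rw [hY, hy, show ‖s‖ + 5 / 2 = 5 / 2 + ‖s‖ by ring]
    exact this
  calc ‖classXiG K χ s‖ ≤ C₀ * Real.exp (k * Y) := hprod
    _ ≤ C₀ * Real.exp (‖s‖ ^ (7 / 4 : ℝ) + A) := by gcongr
    _ = C₀ * Real.exp A * Real.exp (‖s‖ ^ (7 / 4 : ℝ)) := by rw [Real.exp_add]; ring

/-! ### The entire function `ξ(s, χ)` -/

variable (K) in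
/-- **`ξ(s, χ)`**: `G_χ(s)` for `Re s ≥ 1/2` and `W(χ) G_{χ⁻¹}(1 − s)` for `Re s < 1/2` — the entire
function `s(s−1)Λ(s, χ)`. [cite: NeukirchANT1999, Ch. VII (8.5)–(8.6)] -/
def classXi (χ : ClassGroup (𝓞 K) →* ℂˣ) (s : ℂ) : ℂ :=
  if 1 / 2 ≤ s.re then classXiG K χ s else classRootNumber K χ * classXiG K χ⁻¹ (1 - s)

/-- `ξ(s, χ) = G_χ(s)` for `Re s > 0`. [folklore] -/
theorem classXi_eq_of_re_pos (χ : ClassGroup (𝓞 K) →* ℂˣ) {s : ℂ} (hs : 0 < s.re) :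
    classXi K χ s = classXiG K χ s := by
  by_cases h : 1 / 2 ≤ s.re
  · simp only [classXi, h, if_true]
  · simp only [classXi, h, if_false]
    push Not at h
    -- `G_χ(s) = G_χ(1 − (1 − s)) = W(χ) G_{χ⁻¹}(1 − s)` as `1 − s ∉ ℤ`
    have h1s : ∀ n : ℤ, (1 - s) ≠ n := ne_int_of_mem_strip (by simp; linarith) (by simp; linarith)
    have := classXiG_one_sub χ h1s
    rw [sub_sub_cancel] at this
    exact this.symm

/-- `ξ(s, χ) = W(χ) G_{χ⁻¹}(1 − s)` for `Re s < 1`. [folklore] -/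
theorem classXi_eq_of_re_lt_one (χ : ClassGroup (𝓞 K) →* ℂˣ) {s : ℂ} (hs : s.re < 1) :
    classXi K χ s = classRootNumber K χ * classXiG K χ⁻¹ (1 - s) := by
  by_cases h : 1 / 2 ≤ s.re
  · simp only [classXi, h, if_true]
    have hs' : ∀ n : ℤ, (1 - s) ≠ n := ne_int_of_mem_strip (by simp; linarith) (by simp; linarith)
    have := classXiG_one_sub χ hs'
    rw [sub_sub_cancel] at this
    exact this
  · simp only [classXi, h, if_false]

/-- `ξ(s, χ) = s(s − 1) γ_K(s) L(s, χ)` for `Re s > 0`, `s ≠ 1`. [cite: NeukirchANT1999, Ch. VII (8.5)] -/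
theorem classXi_eq_mul (χ : ClassGroup (𝓞 K) →* ℂˣ) {s : ℂ} (hs : 0 < s.re) (hs1 : s ≠ 1) :
    classXi K χ s = s * (s - 1) * (dedekindGammaFactor K s * classGroupLFunction K χ s) := by
  rw [classXi_eq_of_re_pos χ hs, classXiG_eq χ hs1]

/-- **`ξ(·, χ)` is entire.** [cite: NeukirchANT1999, Ch. VII (8.5)] -/
theorem differentiable_classXi (χ : ClassGroup (𝓞 K) →* ℂˣ) : Differentiable ℂ (classXi K χ) := by
  intro s
  rcases lt_or_ge s.re (1 / 2) with h | h
  · have hev : classXi K χ =ᶠ[𝓝 s] fun z ↦ classRootNumber K χ * classXiG K χ⁻¹ (1 - z) := by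
      filter_upwards [(continuous_re.isOpen_preimage _ isOpen_Iio).mem_nhds
        (show s ∈ re ⁻¹' Iio 1 by simp; linarith)] with z hz
      exact classXi_eq_of_re_lt_one χ (by simpa using hz)
    refine DifferentiableAt.congr_of_eventuallyEq ?_ hev
    have h1 : DifferentiableAt ℂ (classXiG K χ⁻¹) (1 - s) :=
      differentiableAt_classXiG χ⁻¹ (by simp; linarith)
    exact (h1.comp s ((differentiableAt_const _).sub differentiableAt_id)).const_mul _
  · have hev : classXi K χ =ᶠ[𝓝 s] classXiG K χ := by
      filter_upwards [(continuous_re.isOpen_preimage _ isOpen_Ioi).mem_nhds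
        (show s ∈ re ⁻¹' Ioi 0 by simp; linarith)] with z hz
      exact classXi_eq_of_re_pos χ (by simpa using hz)
    exact (differentiableAt_classXiG χ (by linarith)).congr_of_eventuallyEq hev

/-- **Functional equation `ξ(1 − s, χ) = W(χ) ξ(s, χ⁻¹)`** for all `s`.
[cite: NeukirchANT1999, Ch. VII (8.6)] -/
theorem classXi_one_sub (χ : ClassGroup (𝓞 K) →* ℂˣ) (s : ℂ) :
    classXi K χ (1 - s) = classRootNumber K χ * classXi K χ⁻¹ s := by
  rcases lt_or_ge s.re (1 / 2) with h | h
  · -- `Re(1−s) > 1/2`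
    rw [classXi_eq_of_re_pos χ (by simp; linarith), classXi_eq_of_re_lt_one χ⁻¹ (by linarith),
      classGroupChar_inv_inv, ← mul_assoc, classRootNumber_mul_inv, one_mul]
  · rw [classXi_eq_of_re_lt_one χ (by simp; linarith), sub_sub_cancel,
      classXi_eq_of_re_pos χ⁻¹ (by linarith)]

/-- **Growth**: `‖ξ(s, χ)‖ ≤ C exp(‖s‖^{15/8})`. [folklore] -/
theorem exists_norm_classXi_le (χ : ClassGroup (𝓞 K) →* ℂˣ) :
    ∃ C : ℝ, 0 ≤ C ∧ ∀ s : ℂ, ‖classXi K χ s‖ ≤ C * Real.exp (‖s‖ ^ (15 / 8 : ℝ)) := by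
  obtain ⟨C₁, hC₁0, hC₁⟩ := exists_norm_classXiG_le K χ
  obtain ⟨C₂, hC₂0, hC₂⟩ := exists_norm_classXiG_le K χ⁻¹
  obtain ⟨A, hA0, hA⟩ := Stark1974.exists_mul_add_rpow_le (μ := 7 / 4) (μ' := 15 / 8) (c := 1)
    (a := 1) (by norm_num) (by norm_num) zero_le_one zero_le_one
  refine ⟨max C₁ C₂ * Real.exp A, by positivity, fun s ↦ ?_⟩
  have key : ∀ (ψ : ClassGroup (𝓞 K) →* ℂˣ) (Cψ : ℝ), Cψ ≤ max C₁ C₂ →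
      (∀ w : ℂ, 1 / 2 ≤ w.re → ‖classXiG K ψ w‖ ≤ Cψ * Real.exp (‖w‖ ^ (7 / 4 : ℝ))) →
      ∀ w : ℂ, 1 / 2 ≤ w.re → ‖w‖ ≤ 1 + ‖s‖ →
        ‖classXiG K ψ w‖ ≤ max C₁ C₂ * Real.exp A * Real.exp (‖s‖ ^ (15 / 8 : ℝ)) := by
    intro ψ Cψ hCψ hψ w hw hws
    have h1 := hψ w hw
    have h2 : ‖w‖ ^ (7 / 4 : ℝ) ≤ ‖s‖ ^ (15 / 8 : ℝ) + A := by
      have := hA ‖s‖ (norm_nonneg s)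
      rw [one_mul] at this
      exact (Real.rpow_le_rpow (norm_nonneg _) hws (by norm_num)).trans this
    calc ‖classXiG K ψ w‖ ≤ Cψ * Real.exp (‖w‖ ^ (7 / 4 : ℝ)) := h1
      _ ≤ max C₁ C₂ * Real.exp (‖s‖ ^ (15 / 8 : ℝ) + A) := by
          gcongr
      _ = max C₁ C₂ * Real.exp A * Real.exp (‖s‖ ^ (15 / 8 : ℝ)) := by rw [Real.exp_add]; ring
  by_cases h : 1 / 2 ≤ s.re
  · have : classXi K χ s = classXiG K χ s := by simp only [classXi, h, if_true]
    rw [this]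
    exact key χ C₁ (le_max_left _ _) hC₁ s h (by linarith [norm_nonneg s])
  · have : classXi K χ s = classRootNumber K χ * classXiG K χ⁻¹ (1 - s) := by
      simp only [classXi, h, if_false]
    rw [this, norm_mul, norm_classRootNumber, one_mul]
    push Not at h
    refine key χ⁻¹ C₂ (le_max_right _ _) hC₂ (1 - s) (by simp; linarith) ?_
    calc ‖1 - s‖ ≤ ‖(1 : ℂ)‖ + ‖s‖ := norm_sub_le _ _
      _ = 1 + ‖s‖ := by simp

/-- `ξ(s, χ) ≠ 0` for `Re s > 1`. [folklore] -/
theorem classXi_ne_zero_of_one_lt_re (χ : ClassGroup (𝓞 K) →* ℂˣ) {s : ℂ} (hs : 1 < s.re) :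
    classXi K χ s ≠ 0 := by
  rw [classXi_eq_of_re_pos χ (by linarith)]
  exact classXiG_ne_zero_of_one_lt_re χ hs

/-- `ξ(s, χ) ≠ 0` for `Re s < 0` (functional equation). [folklore] -/
theorem classXi_ne_zero_of_re_neg (χ : ClassGroup (𝓞 K) →* ℂˣ) {s : ℂ} (hs : s.re < 0) :
    classXi K χ s ≠ 0 := by
  have h := classXi_one_sub χ (1 - s)
  rw [sub_sub_cancel] at h
  rw [h]
  refine mul_ne_zero ?_ (classXi_ne_zero_of_one_lt_re χ⁻¹ (by simp; linarith))
  rw [← norm_pos_iff, norm_classRootNumber]; exact one_pos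

/-- The zeros of `ξ(·, χ)` lie in `0 ≤ Re s ≤ 1`. [folklore] -/
theorem re_mem_of_classXi_eq_zero (χ : ClassGroup (𝓞 K) →* ℂˣ) {s : ℂ} (hs : classXi K χ s = 0) :
    0 ≤ s.re ∧ s.re ≤ 1 := by
  constructor
  · by_contra h; push Not at h; exact classXi_ne_zero_of_re_neg χ h hs
  · by_contra h; push Not at h; exact classXi_ne_zero_of_one_lt_re χ h hs

/-- For `χ ≠ 1`: `ξ(1, χ) = 0`. [folklore] -/
theorem classXi_one {χ : ClassGroup (𝓞 K) →* ℂˣ} (hχ : χ ≠ 1) : classXi K χ 1 = 0 := by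
  rw [classXi_eq_of_re_pos χ (by simp), classXiG_one hχ]

/-- A zero `ρ` of `L(s, χ)` with `Re ρ > 0`, `ρ ≠ 1` is a zero of `ξ(·, χ)`. [folklore] -/
theorem classXi_eq_zero_of_classGroupLFunction_eq_zero (χ : ClassGroup (𝓞 K) →* ℂˣ) {ρ : ℂ}
    (hρ : 0 < ρ.re) (hρ1 : ρ ≠ 1) (h : classGroupLFunction K χ ρ = 0) : classXi K χ ρ = 0 := by
  rw [classXi_eq_of_re_pos χ hρ]
  exact classXiG_eq_zero_of_classGroupLFunction_eq_zero χ hρ1 h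

end Literature.NumberTheory.LFunctions.NumberField

end
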